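import Literature.MathematicalPhysics.QuantumFieldTheory.Balaban1983to89.T4CubeChartExp
import Literature.MathematicalPhysics.QuantumFieldTheory.Balaban1983to89.UnitaryModel
import HarnessLib

/-!
# THE (GR-a) ANCHORED TELESCOPE, LIFTED TO `Theorems/` (def-free): first differences of the organ's remainder along a WINDOW PATH of right
# exponential one-bond moves, from the scaled pair clause (H-currency) + an anchor letter — brick «T» of `V18-TYPING-SPEC-w3g24.md` §4

Cell `ym3-torus` (YM ladder rung R3 = continuum `SU(2)` Yang–Mills on the three-torus — a RUNG, NOT d = 4, NOT infinite volume, NOT a mass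
gap, NOT Clay).  LEAD-20520 width seat `ym-ust-20520-w3` (gen 24); `--supports stmt-QuantumFields-20520 --as helper`, count-neutral,
definition-free, default heartbeats; no registry, binder or `Lines/` edit (registered skeleton `Lines/semiclassical_s2beta.lean` v11.4, 0∕5,
★★OWNER RULING №36, untouched).

WHAT THIS IS.  Ideator `ym-r3-idea-1` g26's crux-dir lemma file `Cruxes/FluctuationComparisonRegPrIntL/GROrganTelescope.lean` (0cc9587713bfa78b, №23;
kernel-checked, critic #585) proves TN-GR's (GR-a) mechanism: the SCALED one-bond-pair clause of O1ᵘ-H (`HClauseSq`, HOME draft `O1uH_draft.lean` :47)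
transports a first-difference bound at an ANCHOR `U₀` along a path of right exponential moves `U ↦ update U b (U b * expPt v)`, at the cost of
one column entry `k bᵢ b · ‖vᵢ‖∕θ` per step.  Crux workfiles are not importable from `Theorems/`; this file LIFTS those lemmas VERBATIM in
mathematics and DEF-FREE in form (the crux file's `applyPath`∕`move` are spelled out as `List.foldl` ∕ `Function.update`), so that the v18
junction `directTransport_supR` (spec §4 (b)) and w4 g22's brick P «small-step window paths» dock on TREE names.  All credit for the argument:
ideator g26.

* §1 ABSTRACT TELESCOPE (any state space `X`, index type `ι`, move type `M`, action `act`, size `sz`): `firstDiff_step`, ★`firstDiff_telescope`,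
  `firstDiff_of_anchor_and_length`; WINDOWED forms `firstDiff_step_on`, ★`firstDiff_telescope_on` (clause assumed only on `Good` squares with
  window-size moves; path hypotheses = every prefix and its `b`-excitation `Good`, every move window-size).
* §2 THE ORGAN'S INSTANCE (`GaugeField P j SU(2)`, right exponential moves): `clause_update_of_HClauseSq` (the relational `HClauseSq` text ⇒ the
  `update` form) and ★★`firstDiff_window_path` — for the HClauseSq TEXT `h` (carried VERBATIM as a hypothesis), a target bond `b` and move `v`
  (`‖v‖∕θ ≤ r`), a path (list of (bond, move)) with window-size moves all of whose prefixes (and their `b`-excitations) are `θ`-small, and an anchor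
  letter `|R (update U₀ b (U₀ b * expPt v)) − R U₀| ≤ G·(‖v‖∕θ)`:
  `|R (update Uend b (Uend b * expPt v)) − R Uend| ≤ (G + Σ_{(bᵢ,vᵢ) ∈ path} k bᵢ b·(‖vᵢ‖∕θ))·(‖v‖∕θ)`, `Uend := path.foldl (fun U p => update U p.1 (U p.1 * expPt p.2)) U₀`.

Inputs the junction supplies: `h` = O1ᵘ-H's OUTPUT clause at height `j`; `G` = the second-order anchor at the FLAT `U₀ = 1` (✓p795667
`abs_flatBond_organDiscrepancy_sub_le_sq`: `G = (32B∕r²)·(‖v‖∕θ)`, first order killed by ✓p794698∘✓p793256); the path = brick P (w4 g22).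
WHAT THIS IS NOT: bookkeeping inequalities; nothing of Bałaban's; O1ᵘ-H (the clause `h` for the runs) is a HYPOTHESIS; O1∕S3ᴴ∕crux 20520∕`YM3TorusSU2`
NOT proved; no summit is proved by a telescope.  R3 = SU(2) YM₃ on T³ — NOT d = 4, NOT infinite volume, NOT a mass gap, NOT Clay; the Yang–Mills mass
gap is NOT proved.
-/

noncomputable section

open Function
open Literature.MathematicalPhysics.QuantumFieldTheory.Balaban1983to89
open T4CubeChartExp (expPt)

namespace Summit.QuantumFields.YangMills.Theorems.OrganTangentTelescopeWindowPath

/-! ## §1 Abstract telescope along a path of moves -/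

section Abstract

variable {X ι M : Type*}

/-- ONE STEP: the scaled pair clause moves a first-difference bound across one move, at the cost of one column entry of `k` (ideator g26,
`GROrganTelescope.Tele.firstDiff_step`). [folklore] -/
theorem firstDiff_step (act : X → ι → M → X) (sz : M → ℝ) (f : X → ℝ) (k : ι → ι → ℝ)
    (hH : ∀ (U : X) (b b' : ι) (m m' : M),
      |f (act (act U b m) b' m') - f (act U b m) - f (act U b' m') + f U| ≤ k b b' * sz m * sz m')
    (U₀ : X) (G : ι → ℝ) (hG : ∀ b m, |f (act U₀ b m) - f U₀| ≤ G b * sz m) (p : ι × M) :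
    ∀ b m, |f (act (act U₀ p.1 p.2) b m) - f (act U₀ p.1 p.2)| ≤ (G b + k p.1 b * sz p.2) * sz m := by
  intro b m
  have h1 := hH U₀ p.1 b p.2 m
  have h2 := hG b m
  have hsplit : f (act (act U₀ p.1 p.2) b m) - f (act U₀ p.1 p.2)
      = (f (act U₀ b m) - f U₀) + (f (act (act U₀ p.1 p.2) b m) - f (act U₀ p.1 p.2) - f (act U₀ b m) + f U₀) := by ring
  rw [hsplit]
  calc |(f (act U₀ b m) - f U₀) + (f (act (act U₀ p.1 p.2) b m) - f (act U₀ p.1 p.2) - f (act U₀ b m) + f U₀)|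
        ≤ |f (act U₀ b m) - f U₀| + |f (act (act U₀ p.1 p.2) b m) - f (act U₀ p.1 p.2) - f (act U₀ b m) + f U₀| := abs_add_le _ _
    _ ≤ G b * sz m + k p.1 b * sz p.2 * sz m := add_le_add h2 h1
    _ = (G b + k p.1 b * sz p.2) * sz m := by ring

/-- ★ TELESCOPING ALONG A PATH (`path.foldl (fun V p => act V p.1 p.2) U₀`): anchor letters `G` at the start plus the column entries of `k` along
the path bound the first differences at the end (ideator g26, `GROrganTelescope.Tele.firstDiff_telescope`). [folklore] -/
theorem firstDiff_telescope (act : X → ι → M → X) (sz : M → ℝ) (f : X → ℝ) (k : ι → ι → ℝ)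
    (hH : ∀ (U : X) (b b' : ι) (m m' : M),
      |f (act (act U b m) b' m') - f (act U b m) - f (act U b' m') + f U| ≤ k b b' * sz m * sz m') :
    ∀ (path : List (ι × M)) (U₀ : X) (G : ι → ℝ),
      (∀ b m, |f (act U₀ b m) - f U₀| ≤ G b * sz m) →
      ∀ b m, |f (act (path.foldl (fun V p => act V p.1 p.2) U₀) b m) - f (path.foldl (fun V p => act V p.1 p.2) U₀)|
        ≤ (G b + (path.map (fun p => k p.1 b * sz p.2)).sum) * sz m := by
  intro path
  induction path with
  | nil =>
    intro U₀ G hG b m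
    simpa using hG b m
  | cons p ps ih =>
    intro U₀ G hG b m
    have hstart := firstDiff_step act sz f k hH U₀ G hG p
    have h := ih (act U₀ p.1 p.2) (fun b => G b + k p.1 b * sz p.2) hstart b m
    rw [List.foldl_cons]
    simpa [List.map_cons, List.sum_cons, add_assoc] using h

/-- The ANCHORED form with a uniform column bound: anchor letters `g₀` at `U₀`, every step's column entry `≤ κb`, path length `N` ⇒ the end-point
first differences are `≤ (g₀ b + N·κb)·sz m` (ideator g26, `…firstDiff_of_anchor_and_length`). [folklore] -/
theorem firstDiff_of_anchor_and_length (act : X → ι → M → X) (sz : M → ℝ) (f : X → ℝ) (k : ι → ι → ℝ)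
    (hH : ∀ (U : X) (b b' : ι) (m m' : M),
      |f (act (act U b m) b' m') - f (act U b m) - f (act U b' m') + f U| ≤ k b b' * sz m * sz m')
    (U₀ : X) (g₀ : ι → ℝ) (hg : ∀ b m, |f (act U₀ b m) - f U₀| ≤ g₀ b * sz m)
    (path : List (ι × M)) (b : ι) (κb : ℝ) (hκ : ∀ p ∈ path, k p.1 b * sz p.2 ≤ κb)
    (m : M) (hm : 0 ≤ sz m) :
    |f (act (path.foldl (fun V p => act V p.1 p.2) U₀) b m) - f (path.foldl (fun V p => act V p.1 p.2) U₀)| ≤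
      (g₀ b + path.length * κb) * sz m := by
  have h := firstDiff_telescope act sz f k hH path U₀ g₀ hg b m
  have hsum : (path.map (fun p => k p.1 b * sz p.2)).sum ≤ path.length * κb := by
    have := List.sum_le_card_nsmul (path.map (fun p => k p.1 b * sz p.2)) κb (by
      intro x hx
      obtain ⟨p, hp, rfl⟩ := List.mem_map.1 hx
      exact hκ p hp)
    simpa [List.length_map, nsmul_eq_mul] using this
  calc |f (act (path.foldl (fun V p => act V p.1 p.2) U₀) b m) - f (path.foldl (fun V p => act V p.1 p.2) U₀)|
        ≤ (g₀ b + (path.map (fun p => k p.1 b * sz p.2)).sum) * sz m := h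
    _ ≤ (g₀ b + path.length * κb) * sz m := by
        apply mul_le_mul_of_nonneg_right _ hm
        linarith

/-- ONE WINDOWED STEP: the clause is assumed only on `Good` squares with moves of size `≤ ρ` (ideator g26, `…firstDiff_step_on`). [folklore] -/
theorem firstDiff_step_on (Good : X → Prop) (ρ : ℝ) (act : X → ι → M → X) (sz : M → ℝ) (f : X → ℝ) (k : ι → ι → ℝ)
    (hH : ∀ (U : X) (b b' : ι) (m m' : M), Good U → Good (act U b m) → Good (act U b' m') → Good (act (act U b m) b' m') →
      sz m ≤ ρ → sz m' ≤ ρ → |f (act (act U b m) b' m') - f (act U b m) - f (act U b' m') + f U| ≤ k b b' * sz m * sz m')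
    (U₀ : X) (p : ι × M) (b : ι) (m : M)
    (hU₀ : Good U₀) (hU₁ : Good (act U₀ p.1 p.2)) (hU₀b : Good (act U₀ b m)) (hU₁b : Good (act (act U₀ p.1 p.2) b m))
    (hp : sz p.2 ≤ ρ) (hm : sz m ≤ ρ)
    (G : ℝ) (hG : |f (act U₀ b m) - f U₀| ≤ G * sz m) :
    |f (act (act U₀ p.1 p.2) b m) - f (act U₀ p.1 p.2)| ≤ (G + k p.1 b * sz p.2) * sz m := by
  have h1 := hH U₀ p.1 b p.2 m hU₀ hU₁ hU₀b hU₁b hp hm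
  have hsplit : f (act (act U₀ p.1 p.2) b m) - f (act U₀ p.1 p.2)
      = (f (act U₀ b m) - f U₀) + (f (act (act U₀ p.1 p.2) b m) - f (act U₀ p.1 p.2) - f (act U₀ b m) + f U₀) := by ring
  rw [hsplit]
  calc |(f (act U₀ b m) - f U₀) + (f (act (act U₀ p.1 p.2) b m) - f (act U₀ p.1 p.2) - f (act U₀ b m) + f U₀)|
        ≤ |f (act U₀ b m) - f U₀| + |f (act (act U₀ p.1 p.2) b m) - f (act U₀ p.1 p.2) - f (act U₀ b m) + f U₀| := abs_add_le _ _
    _ ≤ G * sz m + k p.1 b * sz p.2 * sz m := add_le_add hG h1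
    _ = (G + k p.1 b * sz p.2) * sz m := by ring

/-- ★ WINDOWED TELESCOPING: for a fixed target `b`, `m` (`sz m ≤ ρ`), if every prefix of the path and its `b`-excitation are `Good` and all moves
are window-size, the end-point first difference is `≤ (G + Σ k bᵢ b·sz mᵢ)·sz m` (ideator g26, `…firstDiff_telescope_on`). [folklore] -/
theorem firstDiff_telescope_on (Good : X → Prop) (ρ : ℝ) (act : X → ι → M → X) (sz : M → ℝ) (f : X → ℝ) (k : ι → ι → ℝ)
    (hH : ∀ (U : X) (b b' : ι) (m m' : M), Good U → Good (act U b m) → Good (act U b' m') → Good (act (act U b m) b' m') →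
      sz m ≤ ρ → sz m' ≤ ρ → |f (act (act U b m) b' m') - f (act U b m) - f (act U b' m') + f U| ≤ k b b' * sz m * sz m')
    (b : ι) (m : M) (hm : sz m ≤ ρ) :
    ∀ (path : List (ι × M)) (U₀ : X) (G : ℝ),
      (∀ p ∈ path, sz p.2 ≤ ρ) →
      (∀ n ≤ path.length, Good ((path.take n).foldl (fun V p => act V p.1 p.2) U₀) ∧
        Good (act ((path.take n).foldl (fun V p => act V p.1 p.2) U₀) b m)) →
      |f (act U₀ b m) - f U₀| ≤ G * sz m →
      |f (act (path.foldl (fun V p => act V p.1 p.2) U₀) b m) - f (path.foldl (fun V p => act V p.1 p.2) U₀)|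
        ≤ (G + (path.map (fun p => k p.1 b * sz p.2)).sum) * sz m := by
  intro path
  induction path with
  | nil =>
    intro U₀ G _ _ hG
    simpa using hG
  | cons p ps ih =>
    intro U₀ G hsz hgood hG
    have h0 := hgood 0 (Nat.zero_le _)
    have h1 := hgood 1 (by simp)
    simp only [List.take_zero, List.foldl_nil] at h0
    simp only [List.take_succ_cons, List.take_zero, List.foldl_cons, List.foldl_nil] at h1
    have hstart := firstDiff_step_on Good ρ act sz f k hH U₀ p b m h0.1 h1.1 h0.2 h1.2 (hsz p (by simp)) hm G hG
    have hsz' : ∀ q ∈ ps, sz q.2 ≤ ρ := fun q hq => hsz q (List.mem_cons_of_mem p hq)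
    have hgood' : ∀ n ≤ ps.length, Good ((ps.take n).foldl (fun V p => act V p.1 p.2) (act U₀ p.1 p.2)) ∧
        Good (act ((ps.take n).foldl (fun V p => act V p.1 p.2) (act U₀ p.1 p.2)) b m) := by
      intro n hn
      have := hgood (n + 1) (by simpa using hn)
      simpa [List.take_succ_cons, List.foldl_cons] using this
    have h := ih (act U₀ p.1 p.2) (G + k p.1 b * sz p.2) hsz' hgood' hstart
    rw [List.foldl_cons]
    simpa [List.map_cons, List.sum_cons, add_assoc] using h

end Abstract

/-! ## §2 The organ's instance: right exponential one-bond moves of `SU(2)` gauge fields -/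

section Organ

variable {P : Params} {j : ℕ} [DecidableEq (PBond P j)]

/-- The relational `HClauseSq` text (hypothesis `h`, VERBATIM from the draft) specialised to `update` moves (ideator g26,
`GROrganTelescope.clause_update_of_HClauseSq`). [folklore] -/
theorem clause_update_of_HClauseSq {θ r : ℝ} (hθ : 0 < θ) {k : PBond P j → PBond P j → ℝ}
    {R : GaugeField P j (Matrix.specialUnitaryGroup (Fin 2) ℂ) → ℝ}
    (h : ∀ (b b' : PBond P j) (v v' : Fin 3 → ℝ) (U V W Z : GaugeField P j (Matrix.specialUnitaryGroup (Fin 2) ℂ)),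
      ‖v‖ ≤ r * θ → ‖v'‖ ≤ r * θ → PlaqSmall θ U → PlaqSmall θ V → PlaqSmall θ W → PlaqSmall θ Z →
      (∀ e, e ≠ b → V e = U e) → V b = U b * expPt v → (∀ e, e ≠ b' → W e = U e) → W b' = U b' * expPt v' →
      (∀ e, e ≠ b' → Z e = V e) → Z b' = V b' * expPt v' →
      |R Z - R V - R W + R U| ≤ k b b' * (‖v‖ / θ) * (‖v'‖ / θ)) :
    ∀ (U : GaugeField P j (Matrix.specialUnitaryGroup (Fin 2) ℂ)) (b b' : PBond P j) (v v' : Fin 3 → ℝ),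
      PlaqSmall θ U → PlaqSmall θ (update U b (U b * expPt v)) → PlaqSmall θ (update U b' (U b' * expPt v')) →
      PlaqSmall θ (update (update U b (U b * expPt v)) b' ((update U b (U b * expPt v)) b' * expPt v')) →
      ‖v‖ / θ ≤ r → ‖v'‖ / θ ≤ r →
      |R (update (update U b (U b * expPt v)) b' ((update U b (U b * expPt v)) b' * expPt v')) - R (update U b (U b * expPt v)) -
        R (update U b' (U b' * expPt v')) + R U| ≤ k b b' * (‖v‖ / θ) * (‖v'‖ / θ) := by
  intro U b b' v v' hU hV hW hZ hv hv'
  have hv1 : ‖v‖ ≤ r * θ := by rwa [div_le_iff₀ hθ] at hv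
  have hv1' : ‖v'‖ ≤ r * θ := by rwa [div_le_iff₀ hθ] at hv'
  exact h b b' v v' U (update U b (U b * expPt v)) (update U b' (U b' * expPt v'))
    (update (update U b (U b * expPt v)) b' ((update U b (U b * expPt v)) b' * expPt v')) hv1 hv1' hU hV hW hZ
    (fun e he => update_of_ne he _ _) (update_self _ _ _)
    (fun e he => update_of_ne he _ _) (update_self _ _ _)
    (fun e he => update_of_ne he _ _) (update_self _ _ _)

/-- ★★ **FIRST DIFFERENCES ALONG A WINDOW PATH** from the scaled pair clause (ideator g26, `GROrganTelescope.firstDiff_window_path`, def-free):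
with `Uend := path.foldl (fun U p => update U p.1 (U p.1 * expPt p.2)) U₀`, an anchor letter `G` at `U₀` for the probe `(b, v)`, window-size moves
and θ-small prefixes, `|R (update Uend b (Uend b * expPt v)) − R Uend| ≤ (G + Σ_{(bᵢ,vᵢ)∈path} k bᵢ b·(‖vᵢ‖∕θ))·(‖v‖∕θ)`. [folklore] -/
theorem firstDiff_window_path {θ r : ℝ} (hθ : 0 < θ) {k : PBond P j → PBond P j → ℝ}
    {R : GaugeField P j (Matrix.specialUnitaryGroup (Fin 2) ℂ) → ℝ}
    (h : ∀ (b b' : PBond P j) (v v' : Fin 3 → ℝ) (U V W Z : GaugeField P j (Matrix.specialUnitaryGroup (Fin 2) ℂ)),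
      ‖v‖ ≤ r * θ → ‖v'‖ ≤ r * θ → PlaqSmall θ U → PlaqSmall θ V → PlaqSmall θ W → PlaqSmall θ Z →
      (∀ e, e ≠ b → V e = U e) → V b = U b * expPt v → (∀ e, e ≠ b' → W e = U e) → W b' = U b' * expPt v' →
      (∀ e, e ≠ b' → Z e = V e) → Z b' = V b' * expPt v' →
      |R Z - R V - R W + R U| ≤ k b b' * (‖v‖ / θ) * (‖v'‖ / θ)) (b : PBond P j) (v : Fin 3 → ℝ) (hv : ‖v‖ / θ ≤ r)
    (path : List (PBond P j × (Fin 3 → ℝ))) (U₀ : GaugeField P j (Matrix.specialUnitaryGroup (Fin 2) ℂ)) (G : ℝ)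
    (hsz : ∀ p ∈ path, ‖p.2‖ / θ ≤ r)
    (hgood : ∀ n ≤ path.length,
      PlaqSmall θ ((path.take n).foldl (fun U p => update U p.1 (U p.1 * expPt p.2)) U₀) ∧
      PlaqSmall θ (update ((path.take n).foldl (fun U p => update U p.1 (U p.1 * expPt p.2)) U₀) b
        (((path.take n).foldl (fun U p => update U p.1 (U p.1 * expPt p.2)) U₀) b * expPt v)))
    (hG : |R (update U₀ b (U₀ b * expPt v)) - R U₀| ≤ G * (‖v‖ / θ)) :
    |R (update (path.foldl (fun U p => update U p.1 (U p.1 * expPt p.2)) U₀) b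
        ((path.foldl (fun U p => update U p.1 (U p.1 * expPt p.2)) U₀) b * expPt v)) -
      R (path.foldl (fun U p => update U p.1 (U p.1 * expPt p.2)) U₀)|
      ≤ (G + (path.map (fun p => k p.1 b * (‖p.2‖ / θ))).sum) * (‖v‖ / θ) :=
  firstDiff_telescope_on (PlaqSmall θ) r
    (fun (U : GaugeField P j (Matrix.specialUnitaryGroup (Fin 2) ℂ)) (b : PBond P j) (v : Fin 3 → ℝ) => update U b (U b * expPt v))
    (fun w : Fin 3 → ℝ => ‖w‖ / θ) R k (clause_update_of_HClauseSq hθ h) b v hv path U₀ G hsz hgood hG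

end Organ

end Summit.QuantumFields.YangMills.Theorems.OrganTangentTelescopeWindowPath

end
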